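import Summits.Ventures.PercRepro.Night2DQm1Loss

/-!
# PercRepro — the spread regime: no saturated covering set, hence (LI_G) (night-2, gen 19)

At a rank-`(q+1)` flat `G` with `|E ∖ G| = d ≤ q`, `K = coloops (M|G)`, `k = kColoops`, `ρ = q + 1 − k`, `M` simple
loopless: every shadow set has at most `ρ` thin covering preimages (`card_thin_coverPreimages_le_rho`: they are
`S ∖ w` for coloops `w` of `M|(S ∖ K)`, a set of rank `ρ`), and a thin member with `|G ∖ cl B| ≥ m₀` requests at most
`Φ/(m₀ + d)`.  So if EVERY thin member misses at least `m₀` points of `G` («`m₀`-spread»: every hyperplane of `M|G`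
through `K` that is the closure of a bottom set misses `≥ m₀` points), then `L1 S ≤ ρΦ/(m₀ + d)` at every covering
set, and as soon as `ρΦ/(m₀ + d) ≤ 1 − kΦ/(1 + d)` no covering set is saturated, no loss occurs and the fair-share
certificate closes (LI_G) with nothing to route (**`localShadowHall_of_spread`**).

At `q = 5` this settles the five remaining cells of the `(7, 5)` row in the spread regime: `(3, 2)` for `m₀ = 9`,
`(3, 1)` for `m₀ = 6`, `(3, 0)` for `m₀ = 4`, `(2, 1)` for `m₀ = 8`, `(2, 0)` for `m₀ = 5` (the arithmetic is exact:
e.g. `(3, 2)`: `4 · (7/6)/12 = 7/18 ≤ 5/12`).  What remains of each cell is the «fat hyperplane» regime — some bottom-set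
closure misses fewer than `m₀` points of `G ∖ K` — where saturated covering sets, hence losses, can occur
(`proofs/NIGHT-2-g19.md` §5).
-/

namespace PercRepro.Shadow

open Finset PerFlat ThmH

variable {α : Type*} [DecidableEq α] {M : Matroid α} [M.Finite]

open scoped Classical in
/-- A shadow set with closure `G` has at most `ρ` thin covering preimages (`|E ∖ G| ≤ q`, `kColoops + ρ = q + 1`). -/
theorem card_thin_coverPreimages_le_rho {q ρ : ℕ} {G : Finset α} (hG : G ∈ flatsQ M (q + 1))
    (hd : (gr M \ G).card ≤ q) (hk : kColoops M G + ρ = q + 1) {S : Finset α}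
    (hS : S ∈ shadowAt M (q + 2) q (Uq M (q + 2) q) G) :
    ((coverPreimages M (Uq M (q + 2) q) G S).filter (fun B => B ∉ lay0 M q G)).card ≤ ρ := by
  have hGg : G ⊆ gr M := (mem_flatsQ.1 hG).1
  have hSG : S ⊆ G := subset_G_of_mem_shadowAt hS
  have hPg : S \ coloops M G ⊆ gr M := Finset.sdiff_subset.trans (hSG.trans hGg)
  have hPr := eRk_sdiff_coloops_eq_of_mem_shadowAt hG hk hS
  have hC := card_coloops_le hPg hPr
  have h1 := Finset.card_le_card (thin_coverPreimages_subset_image_coloops hG hd S)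
  have h2 := Finset.card_image_le (s := coloops M (S \ coloops M G)) (f := fun w => S.erase w)
  omega

/-- A thin member missing at least `m₀` points of `G` requests at most `Φ/(m₀ + d)`. -/
theorem req_le_of_spread {q d m₀ : ℕ} {G : Finset α} (hG : G ∈ flatsQ M (q + 1)) (hd : (gr M \ G).card = d)
    {B : Finset α} (hB : B ∈ thinMembers M q G) (hm : m₀ ≤ (G \ clF M B).card) :
    req M q B ≤ phiQ q / ((m₀ : ℚ) + (d : ℚ)) := by
  have hB' : B ∈ membersIn M (Uq M (q + 2) q) G := (mem_thinMembers.1 hB).1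
  have hBG : clF M B ⊆ G := (mem_membersIn.1 hB').2
  have hd1 : 1 ≤ d := by rw [← hd]; exact one_le_card_compl_of_member hG (mem_membersIn.1 hB').1
  unfold req
  have hc : (m₀ : ℚ) + (d : ℚ) ≤ ((gr M \ clF M B).card : ℚ) := by
    rw [card_compl_clF_add hG hBG, hd]
    have : m₀ + d ≤ (G \ clF M B).card + d := by omega
    exact_mod_cast this
  have hpos : (0 : ℚ) < (m₀ : ℚ) + (d : ℚ) := by
    have : (1 : ℚ) ≤ (d : ℚ) := by exact_mod_cast hd1
    positivity
  exact div_le_div_of_nonneg_left (phiQ_pos q).le hpos hc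

open scoped Classical in
/-- In the `m₀`-spread regime `L1 S ≤ ρΦ/(m₀ + d)` at every shadow set. -/
theorem L1_le_of_spread {q d ρ m₀ : ℕ} {G : Finset α} (hG : G ∈ flatsQ M (q + 1)) (hd : (gr M \ G).card = d)
    (hdq : d ≤ q) (hk : kColoops M G + ρ = q + 1) (hm : ∀ B ∈ thinMembers M q G, m₀ ≤ (G \ clF M B).card)
    {S : Finset α} (hS : S ∈ shadowAt M (q + 2) q (Uq M (q + 2) q) G) :
    L1 M q G S ≤ (ρ : ℚ) * (phiQ q / ((m₀ : ℚ) + (d : ℚ))) := by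
  have hd' : (gr M \ G).card ≤ q := by omega
  unfold L1
  have hterm : ∀ B ∈ (coverPreimages M (Uq M (q + 2) q) G S).filter (fun B => B ∉ lay0 M q G),
      req M q B ≤ phiQ q / ((m₀ : ℚ) + (d : ℚ)) := by
    intro B hB
    rw [Finset.mem_filter, mem_coverPreimages] at hB
    have hBt : B ∈ thinMembers M q G := mem_thinMembers.2 ⟨hB.1.1, hB.2⟩
    exact req_le_of_spread hG hd hBt (hm B hBt)
  have hcount := card_thin_coverPreimages_le_rho hG hd' hk hS
  have hnn : 0 ≤ phiQ q / ((m₀ : ℚ) + (d : ℚ)) := div_nonneg (phiQ_pos q).le (by positivity)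
  calc ∑ B ∈ (coverPreimages M (Uq M (q + 2) q) G S).filter (fun B => B ∉ lay0 M q G), req M q B
      ≤ ∑ _B ∈ (coverPreimages M (Uq M (q + 2) q) G S).filter (fun B => B ∉ lay0 M q G),
          phiQ q / ((m₀ : ℚ) + (d : ℚ)) := Finset.sum_le_sum hterm
    _ = (((coverPreimages M (Uq M (q + 2) q) G S).filter (fun B => B ∉ lay0 M q G)).card : ℚ) *
          (phiQ q / ((m₀ : ℚ) + (d : ℚ))) := by rw [Finset.sum_const, nsmul_eq_mul]
    _ ≤ (ρ : ℚ) * (phiQ q / ((m₀ : ℚ) + (d : ℚ))) := by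
        apply mul_le_mul_of_nonneg_right _ hnn
        exact_mod_cast hcount

/-- `capS S ≥ 1 − kΦ/(1 + d)` for every `S ⊆ G` (`|E ∖ G| = d`). -/
theorem capS_ge_one_sub_kColoops {q d : ℕ} {G : Finset α} (hd : (gr M \ G).card = d) {S : Finset α}
    (hS : S ⊆ G) : 1 - (kColoops M G : ℚ) * phiQ q / (1 + (d : ℚ)) ≤ capS M q G S := by
  unfold capS
  have hk1 : (k1 M q G S : ℚ) ≤ (kColoops M G : ℚ) := by exact_mod_cast k1_le_kColoops hS
  rw [hd]
  apply sub_le_sub_left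
  apply div_le_div_of_nonneg_right _ (by positivity)
  exact mul_le_mul_of_nonneg_right hk1 (phiQ_pos q).le

open scoped Classical in
/-- **THE SPREAD REGIME**: if every thin member below `G` misses at least `m₀` points of `G` and
`ρΦ/(m₀ + d) ≤ 1 − kΦ/(1 + d)` (`|E ∖ G| = d ≤ q`, `kColoops + ρ = q + 1`, `M` simple loopless), then no covering set
is saturated and the local form (LI_G) holds. -/
theorem localShadowHall_of_spread {q d ρ m₀ : ℕ} {G : Finset α} (hG : G ∈ flatsQ M (q + 1))
    (hd : (gr M \ G).card = d) (hdq : d ≤ q) (hk : kColoops M G + ρ = q + 1)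
    (hm : ∀ B ∈ thinMembers M q G, m₀ ≤ (G \ clF M B).card)
    (harith : (ρ : ℚ) * (phiQ q / ((m₀ : ℚ) + (d : ℚ))) ≤ 1 - (kColoops M G : ℚ) * phiQ q / (1 + (d : ℚ))) :
    LocalShadowHall M q G := by
  have hd' : (gr M \ G).card ≤ q := by omega
  apply localShadowHall_of_lossFair hG hd'
  intro B hB z hz
  have hSsh := insert_mem_shadowAt_thin hG hB hz
  have hSG : insert z B ⊆ G := subset_G_of_mem_shadowAt hSsh
  have hL : L1 M q G (insert z B) ≤ capS M q G (insert z B) :=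
    (L1_le_of_spread hG hd hdq hk hm hSsh).trans (harith.trans (capS_ge_one_sub_kColoops hd hSG))
  have hl0 : loss M q G B z = 0 := by
    unfold loss fS
    rw [if_pos hL]
    ring
  rw [hl0]
  exact mul_nonneg (rhoL_nonneg hG hd' B z) (lossIncome_nonneg hG hd' B z)

/-! ## The five remaining `(7, 5)` cells in their spread regimes -/

open scoped Classical in
/-- The cell `(3, 2)` in the `9`-spread regime. -/
theorem localShadowHall_three_two_five_of_spread {G : Finset α} (hG : G ∈ flatsQ M (5 + 1))
    (hd : (gr M \ G).card = 3) (hk : kColoops M G = 2)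
    (hm : ∀ B ∈ thinMembers M 5 G, 9 ≤ (G \ clF M B).card) : LocalShadowHall M 5 G :=
  localShadowHall_of_spread (ρ := 4) hG hd (by norm_num) (by rw [hk]) hm
    (by rw [hk]; unfold phiQ; norm_num)

open scoped Classical in
/-- The cell `(3, 1)` in the `6`-spread regime. -/
theorem localShadowHall_three_one_five_of_spread {G : Finset α} (hG : G ∈ flatsQ M (5 + 1))
    (hd : (gr M \ G).card = 3) (hk : kColoops M G = 1)
    (hm : ∀ B ∈ thinMembers M 5 G, 6 ≤ (G \ clF M B).card) : LocalShadowHall M 5 G :=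
  localShadowHall_of_spread (ρ := 5) hG hd (by norm_num) (by rw [hk]) hm
    (by rw [hk]; unfold phiQ; norm_num)

open scoped Classical in
/-- The cell `(3, 0)` in the `4`-spread regime. -/
theorem localShadowHall_three_zero_five_of_spread {G : Finset α} (hG : G ∈ flatsQ M (5 + 1))
    (hd : (gr M \ G).card = 3) (hk : kColoops M G = 0)
    (hm : ∀ B ∈ thinMembers M 5 G, 4 ≤ (G \ clF M B).card) : LocalShadowHall M 5 G :=
  localShadowHall_of_spread (ρ := 6) hG hd (by norm_num) (by rw [hk]) hm
    (by rw [hk]; unfold phiQ; norm_num)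

open scoped Classical in
/-- The cell `(2, 1)` in the `8`-spread regime. -/
theorem localShadowHall_two_one_five_of_spread {G : Finset α} (hG : G ∈ flatsQ M (5 + 1))
    (hd : (gr M \ G).card = 2) (hk : kColoops M G = 1)
    (hm : ∀ B ∈ thinMembers M 5 G, 8 ≤ (G \ clF M B).card) : LocalShadowHall M 5 G :=
  localShadowHall_of_spread (ρ := 5) hG hd (by norm_num) (by rw [hk]) hm
    (by rw [hk]; unfold phiQ; norm_num)

open scoped Classical in
/-- The cell `(2, 0)` in the `5`-spread regime. -/
theorem localShadowHall_two_zero_five_of_spread {G : Finset α} (hG : G ∈ flatsQ M (5 + 1))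
    (hd : (gr M \ G).card = 2) (hk : kColoops M G = 0)
    (hm : ∀ B ∈ thinMembers M 5 G, 5 ≤ (G \ clF M B).card) : LocalShadowHall M 5 G :=
  localShadowHall_of_spread (ρ := 6) hG hd (by norm_num) (by rw [hk]) hm
    (by rw [hk]; unfold phiQ; norm_num)

end PercRepro.Shadow
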